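import Summits.Ventures.PercRepro.S2GiantExactCount

/-!
# PercRepro — THE TELESCOPING FORM: the per-level bound `lamTel`, the least rank `rminF`, the `N`-side `nsideTel`
(p8, gen 20; a feeder for S4 — the top of the `q = 7` window, the rows `64 … 56`)

The DEFINITIONS of the telescoping count (S2TelescopeLevels / S2TelescopeCount) and of its level-`7` core
(RankLevelSetCoreSevenOfFormTel), in one module so that the numeric cell forms of every row depend on nothing else:
* **`S2.rminF`** — the least rank of a simple set of nullity `ν` under the `e`-free flat bounds `3, 6, 10, 19, 39`
  (`2, 3, 3, 4, 4, 4, 5 … 5, 6 … 6, 7 …`); a rank-`7` set of nullity `ν ≥ 1` has at least `ν + rminF ν` non-coloops;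
* **`S2.lamTel c P F ρ`** — the per-level bound: `Λ(0) = c`,
  `Λ(ν + 1) = min (P·C(F, ν)/quart(ν + 1)) (Λ(ν)·(F + 1 − ν)/ρ(ν + 1))` (`quart(ν) = ν + 3C(ν,2) + 3C(ν,3) + 2C(ν,4)`);
  monotone in `P` (`lamTel_mono`);
* **`ThmN.nsideTel p d S3 S4 S5`** — the `N`-side of a level-`7` cell `(p, d)`:
  `C(n, 7) + Σ_{j < d − 7} Λ(j + 1) + 2^{min 79 (7 + d)}` with `c = C(n, 7)`, `F = min 71 (ν₁ − 2)`, `ρ(ν) = ν + rminF ν` and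
  `P = S3·C(n − 3, 5) + S4·C(n − 4, 4) + S5·C(n − 5, 3) + C(d+5, 6)·C(n − 6, 2) + C(d+6, 7)·(n − 7) + C(d+7, 8)` — THE
  DISJOINT PAIR COUNT with the `3`- / `4`- / `5`-circuit bounds as parameters.
Axioms: standard.
-/

namespace PercRepro

namespace S2

/-- **The least rank of a simple set of nullity `ν` in the `e`-free core**: the least `r` with `r + ν ≤ f_r` for the flat
bounds `f₂ = 3`, `f₃ = 6`, `f₄ = 10`, `f₅ = 19`, `f₆ = 39` (and `7` beyond `ν = 33`). -/
def rminF (ν : ℕ) : ℕ :=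
  if ν ≤ 1 then 2 else if ν ≤ 3 then 3 else if ν ≤ 6 then 4 else if ν ≤ 14 then 5 else if ν ≤ 33 then 6 else 7

/-- `rminF ν ≥ 1` (it is `≥ 2`). -/
theorem one_le_rminF (ν : ℕ) : 1 ≤ rminF ν := by
  unfold rminF
  split_ifs <;> omega

/-- **The per-level bound of the telescoping count**: `Λ(0) = c`,
`Λ(ν + 1) = min (P·C(F, ν)/quart(ν + 1)) (Λ(ν)·(F + 1 − ν)/ρ(ν + 1))`. -/
def lamTel (c P : ℚ) (F : ℕ) (ρ : ℕ → ℕ) : ℕ → ℚ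
  | 0 => c
  | ν + 1 => min (P * ((F.choose ν : ℕ) : ℚ) /
      (((ν + 1) + 3 * (ν + 1).choose 2 + 3 * (ν + 1).choose 3 + 2 * (ν + 1).choose 4 : ℕ) : ℚ))
      (lamTel c P F ρ ν * (((F + 1 - ν : ℕ) : ℚ) / ((ρ (ν + 1) : ℕ) : ℚ)))

/-- `Λ(0) = c`. -/
theorem lamTel_zero (c P : ℚ) (F : ℕ) (ρ : ℕ → ℕ) : lamTel c P F ρ 0 = c := rfl

/-- The recursion of `lamTel` at `ν + 1`. -/
theorem lamTel_succ (c P : ℚ) (F : ℕ) (ρ : ℕ → ℕ) (ν : ℕ) :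
    lamTel c P F ρ (ν + 1) = min (P * ((F.choose ν : ℕ) : ℚ) /
      (((ν + 1) + 3 * (ν + 1).choose 2 + 3 * (ν + 1).choose 3 + 2 * (ν + 1).choose 4 : ℕ) : ℚ))
      (lamTel c P F ρ ν * (((F + 1 - ν : ℕ) : ℚ) / ((ρ (ν + 1) : ℕ) : ℚ))) := rfl

/-- `lamTel` is monotone in the pair count `P` (for `c ≥ 0`, the second branch is a non-negative multiple of the
previous level). -/
theorem lamTel_mono (c P P' : ℚ) (F : ℕ) (ρ : ℕ → ℕ) (hP : P ≤ P') (ν : ℕ) :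
    lamTel c P F ρ ν ≤ lamTel c P' F ρ ν := by
  induction ν with
  | zero => rw [lamTel_zero, lamTel_zero]
  | succ ν ih =>
    rw [lamTel_succ, lamTel_succ]
    apply min_le_min
    · apply div_le_div_of_nonneg_right _ (Nat.cast_nonneg _)
      exact mul_le_mul_of_nonneg_right hP (Nat.cast_nonneg _)
    · apply mul_le_mul_of_nonneg_right ih
      exact div_nonneg (Nat.cast_nonneg _) (Nat.cast_nonneg _)

end S2

namespace ThmN

/-- **The `N`-side of the telescoping count at level `7`**: `C(n, 7) + Σ_{j < d − 7} Λ(j + 1) + 2^{min 79 (7 + d)}`,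
`Λ = lamTel (C(n, 7)) Π′ (min 71 (ν₁ − 2)) (ν ↦ ν + r_min(ν))`, `Π′` the disjoint pair count with the circuit bounds
`S3, S4, S5` and the nullity bounds `C(d + k − 1, k)` for `k = 6, 7, 8`. -/
def nsideTel (p d S3 S4 S5 : ℕ) : ℚ :=
  (((p + d).choose 7 : ℕ) : ℚ) +
    (∑ j ∈ Finset.range (d - 7), S2.lamTel (((p + d).choose 7 : ℕ) : ℚ)
      (((S3 : ℕ) : ℚ) * (((p + d - 3).choose 5 : ℕ) : ℚ) + ((S4 : ℕ) : ℚ) * (((p + d - 4).choose 4 : ℕ) : ℚ) +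
        ((S5 : ℕ) : ℚ) * (((p + d - 5).choose 3 : ℕ) : ℚ) +
        (((d + 5).choose 6 : ℕ) : ℚ) * (((p + d - 6).choose 2 : ℕ) : ℚ) +
        (((d + 6).choose 7 : ℕ) : ℚ) * (((p + d - 7 : ℕ)) : ℚ) + (((d + 7).choose 8 : ℕ) : ℚ))
      (min 71 (max ((d + min 33 d) / 2 + 1) (min 32 (d - 1) + 2) - 2)) (fun ν => ν + S2.rminF ν) (j + 1)) +
    (2 : ℚ) ^ (min 79 (7 + d))

end ThmN

end PercRepro
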